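import Mathlib
import Literature.NumberTheory.Transcendental.NormDescentAlongSequence
import Summits.Schanuel.Schanuel.Theses.RigidCore

/-!
# Deep linear torsion cusps carry finitely many hits (stub `stub_deepCuspFinite`)

Stub (pocket "depth `≥ e(d-1)`") of the line `cusp-germ-schneider-sparsity` for the crux
`RigidCore.SparsityTwo` (item stmt-Schanuel-0971). In the algebraic uniformiser `t` of a LINEAR
TORSION HOMOGENEOUS cusp of a `ℚ`-curve the hits `n` satisfy `(t n)⁻ᵉ = 2πi n + c n` with `c n`
convergent, and the hit condition reads `β (q n + m₁) + q Φ(t n)/(2πi) ∈ ℤ`, where `β` is the real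
algebraic slope and `Φ` the defect germ (analytic at `0`, `Φ 0 = 0`, `Φ ≢ 0` near `0`, algebraic
Taylor coefficients). If `Φ` vanishes to order `≥ e(d-1)`, `d = deg (minpoly ℚ β)`, there are
only finitely many hits:

* `d = 1` (`β ∈ ℚ`): the integers `den(β) · q Φ(t n)/(2πi)` tend to `0`, hence vanish at all
  large hits, so `Φ` vanishes at points accumulating at `0` — identity theorem
  (`eventually_zero_of_infinite_ratSlope_hits`);
* `d ≥ 2`: with `M n = q n + m₁`, `k₀ = e(d-1)`, Taylor's formula
  `Φ z = φ z^{k₀}/k₀! + z^{k₀+1} F z` (`φ = Φ^{(k₀)}(0)`, `F` analytic) and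
  `(t n)^{k₀} = ((t n)^e)^{d-1}`, `M n (t n)^e → q/(2πi)` give
  `(M n)^{d-1} · q Φ(t n)/(2πi) → κ = (q/(2πi))^d φ/k₀!`; `κ π^d = (q/(2i))^d φ/k₀!` is algebraic,
  so `κ` is zero or transcendental (`eq_zero_of_isAlgebraic_of_mul_pi_pow`, Lindemann), and the
  norm descent `finite_setOf_slope_hit_of_normLimit_seq` along `M n`, run with a primitive integer
  multiple of `minpoly ℚ β` (no rational root since `d ≥ 2`, simple root by separability),
  concludes. This contains the disprover's benchmark `shapiroW` (`β = √2`, `e = 1`, `d = 2`).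

Sources: Mathlib (`AnalyticAt.exists_eq_sum_add_pow_mul`, `minpoly`, `integerNormalization`,
`Irreducible.separable`) and the Literature file `NormDescentAlongSequence`.
-/

set_option linter.dupNamespace false

namespace Summit.Schanuel.Schanuel.Cruxes.SparsityTwo.CuspGermSchneiderSparsity

open Filter Topology Complex Polynomial Literature.NumberTheory.Transcendental
open scoped Real

/-- A primitive integer multiple of the minimal polynomial of a real algebraic number `x` of
degree `≥ 2`: an `f ∈ ℤ[X]` of the same degree, without rational roots, having `x` as a SIMPLE
root. -/
private theorem exists_intPoly_of_minpoly {x : ℝ} (hx : IsIntegral ℚ x)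
    (hd : 2 ≤ (minpoly ℚ x).natDegree) :
    ∃ f : ℤ[X], f.natDegree = (minpoly ℚ x).natDegree ∧ (∀ r : ℚ, aeval (r : ℝ) f ≠ 0) ∧
      aeval x f = 0 ∧ aeval x (derivative f) ≠ 0 := by
  set f₀ : ℚ[X] := minpoly ℚ x with hf₀
  obtain ⟨b, hb, hfmap⟩ := IsLocalization.integerNormalization_spec (nonZeroDivisors ℤ) f₀
  set f : ℤ[X] := IsLocalization.integerNormalization (nonZeroDivisors ℤ) f₀ with hf
  have hb0 : (b : ℤ) ≠ 0 := nonZeroDivisors.ne_zero hb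
  have hbQ : (b : ℚ) ≠ 0 := Int.cast_ne_zero.mpr hb0
  have hfmap' : f.map (algebraMap ℤ ℚ) = C (b : ℚ) * f₀ := by
    rw [hfmap, zsmul_eq_mul, ← C_eq_intCast]
  have hirr : Irreducible f₀ := minpoly.irreducible hx
  refine ⟨f, ?_, ?_, ?_, ?_⟩
  · rw [← natDegree_map_eq_of_injective (algebraMap ℤ ℚ).injective_int f, hfmap',
      natDegree_C_mul hbQ]
  · intro r hr
    have h1 : aeval (r : ℝ) (f.map (algebraMap ℤ ℚ)) = 0 := by
      rw [Polynomial.aeval_map_algebraMap]; exact hr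
    rw [hfmap', map_mul, aeval_C, mul_eq_zero] at h1
    rcases h1 with h1 | h1
    · exact hbQ (by simpa using h1)
    · have h3 : aeval ((r : ℚ) : ℝ) f₀ = algebraMap ℚ ℝ (aeval r f₀) := by
        rw [← eq_ratCast (algebraMap ℚ ℝ) r, Polynomial.aeval_algebraMap_apply]
      rw [h1] at h3
      have h2 : aeval r f₀ = 0 :=
        (map_eq_zero_iff _ (algebraMap ℚ ℝ).injective).mp h3.symm
      have hdeg := degree_eq_one_of_irreducible_of_root hirr h2
      have : f₀.natDegree = 1 := natDegree_eq_of_degree_eq_some hdeg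
      omega
  · exact IsLocalization.integerNormalization_aeval_eq_zero (nonZeroDivisors ℤ) f₀
      (minpoly.aeval ℚ x)
  · have h1 : aeval x (derivative f) = aeval x ((derivative f).map (algebraMap ℤ ℚ)) := by
      rw [Polynomial.aeval_map_algebraMap]
    rw [h1, ← derivative_map, hfmap', derivative_C_mul, map_mul, aeval_C]
    refine mul_ne_zero ?_ (hirr.separable.aeval_derivative_ne_zero (minpoly.aeval ℚ x))
    rw [eq_ratCast]
    exact_mod_cast hb0

/-- **stub_deepCuspFinite** (POCKET "depth `≥ e(d-1)`" of the linear torsion homogeneous cusp).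
With `d = deg_ℚ β`, `M n = q n + m₁`, `r n = q Φ(t n)/(2πi)`, a hit is `β M n + r n ∈ ℤ`.
`d = 1`: `β ∈ ℚ`, the integers `den(β) r n → 0` vanish at large hits, identity theorem
(`eventually_zero_of_infinite_ratSlope_hits`). `d ≥ 2`: Taylor `Φ z = φ z^{k₀}/k₀! + z^{k₀+1} F z`,
`k₀ = e(d-1)`, and `(t n)^{k₀} = ((t n)^e)^{d-1}`, `M n (t n)^e → q/(2πi)`, give
`(M n)^{d-1} r n → κ = (q/(2πi))^d φ/k₀!`, an algebraic multiple of `π^{-d}`, zero or transcendental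
(`eq_zero_of_isAlgebraic_of_mul_pi_pow`); norm descent along `M n` with a primitive integer
multiple of `minpoly ℚ β` (no rational root, simple root) concludes
(`finite_setOf_slope_hit_of_normLimit_seq`). -/
theorem stub_deepCuspFinite :
    ∀ (e q : ℕ) (m₁ : ℤ) (β : ℂ) (Φ : ℂ → ℂ) (t c : ℕ → ℂ) (lam : ℂ),
      0 < e → 0 < q → β.im = 0 → IsAlgebraic ℚ β →
      AnalyticAt ℂ Φ 0 → Φ 0 = 0 → (¬ ∀ᶠ z in 𝓝 (0 : ℂ), Φ z = 0) →
      (∀ n : ℕ, IsAlgebraic ℚ (iteratedDeriv n Φ 0)) →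
      (∀ j : ℕ, j < e * ((minpoly ℚ β).natDegree - 1) → iteratedDeriv j Φ 0 = 0) →
      Tendsto t atTop (𝓝 0) → Tendsto c atTop (𝓝 lam) →
      (∀ᶠ n : ℕ in atTop, t n ≠ 0 ∧ ((t n) ^ e)⁻¹ = 2 * ↑π * I * (n : ℂ) + c n) →
      Set.Finite {n : ℕ | ∃ L : ℤ,
        β * ((q : ℂ) * (n : ℂ) + (m₁ : ℂ)) + (q : ℂ) * Φ (t n) / (2 * ↑π * I) = L} := by
  intro e q m₁ β Φ t c lam he hq hβim hβalg hΦan hΦ0 hΦne hcoef hvan ht hc hrel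
  -- `β = x` is real
  obtain ⟨x, rfl⟩ : ∃ x : ℝ, (x : ℂ) = β := ⟨β.re, Complex.ext (by simp) (by simp [hβim])⟩
  have hxalg : IsAlgebraic ℚ x := by
    rw [← isAlgebraic_algebraMap_iff (R := ℚ) (A := ℂ) (algebraMap ℝ ℂ).injective,
      Complex.coe_algebraMap]
    exact hβalg
  have hxint : IsIntegral ℚ x := isAlgebraic_iff_isIntegral.mp hxalg
  have hminC : minpoly ℚ (x : ℂ) = minpoly ℚ x := by
    have h := minpoly.algebraMap_eq (A := ℚ) (algebraMap ℝ ℂ).injective x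
    rwa [Complex.coe_algebraMap] at h
  rw [hminC] at hvan
  set d : ℕ := (minpoly ℚ x).natDegree with hd_def
  have hdpos : 0 < d := minpoly.natDegree_pos hxint
  -- common data
  have h2pi : (2 * (π : ℂ) * I) ≠ 0 := by simp [Real.pi_ne_zero, I_ne_zero]
  have hqC : (q : ℂ) ≠ 0 := Nat.cast_ne_zero.mpr hq.ne'
  have htne : Tendsto t atTop (𝓝[≠] 0) :=
    tendsto_nhdsWithin_iff.mpr ⟨ht, hrel.mono fun n hn => hn.1⟩
  set M : ℕ → ℤ := fun n => (q : ℤ) * n + m₁ with hM_def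
  have hMC : ∀ n : ℕ, ((M n : ℤ) : ℂ) = (q : ℂ) * (n : ℂ) + (m₁ : ℂ) := fun n => by
    simp [hM_def]
  by_cases hd1 : d = 1
  · -- RATIONAL slope: identity theorem
    obtain ⟨b₀, hb₀⟩ := minpoly.natDegree_eq_one_iff.mp hd1
    have hxb : ((x : ℝ) : ℂ) = ((b₀ : ℚ) : ℂ) := by
      rw [← hb₀, eq_ratCast, Complex.ofReal_ratCast]
    by_contra hinf
    apply hΦne
    have hg : AnalyticAt ℂ (fun z => (q : ℂ) * Φ z / (2 * π * I)) 0 :=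
      (analyticAt_const.mul hΦan).div analyticAt_const h2pi
    have hg0 : (fun z => (q : ℂ) * Φ z / (2 * π * I)) 0 = 0 := by simp [hΦ0]
    have hinf' : Set.Infinite {n : ℕ | ∃ L : ℤ,
        ((b₀ : ℚ) : ℂ) * (M n : ℂ) + (fun z => (q : ℂ) * Φ z / (2 * π * I)) (t n) = L} := by
      refine (Set.not_finite.mp hinf).mono ?_
      rintro n ⟨L, hL⟩
      refine ⟨L, ?_⟩
      rw [hMC, ← hxb]
      dsimp only
      linear_combination hL
    have hev := eventually_zero_of_infinite_ratSlope_hits hg hg0 htne hinf'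
    filter_upwards [hev] with z hz
    rw [div_eq_zero_iff, mul_eq_zero] at hz
    rcases hz with (h | h) | h
    · exact absurd h hqC
    · exact h
    · exact absurd h h2pi
  · -- IRRATIONAL slope, `d ≥ 2`: norm descent along `M n`
    have hd2 : 2 ≤ d := by omega
    obtain ⟨f, hfdeg, hnorat, hroot, hsimple⟩ := exists_intPoly_of_minpoly hxint hd2
    -- `M n → +∞`
    have hMtop : Tendsto M atTop atTop := by
      refine tendsto_atTop_mono (fun n => ?_)
        (tendsto_atTop_add_const_right atTop m₁ tendsto_natCast_atTop_atTop)
      have h1 : (1 : ℤ) ≤ q := by exact_mod_cast hq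
      simp only [hM_def]
      nlinarith [Int.natCast_nonneg n]
    -- `u n := M n · (t n)^e → u₀ := q/(2πi)`
    set u₀ : ℂ := (q : ℂ) / (2 * π * I) with hu₀
    have hinv : Tendsto (fun n : ℕ => (n : ℂ)⁻¹) atTop (𝓝 0) := tendsto_inv_atTop_nhds_zero_nat
    have hu : Tendsto (fun n => (M n : ℂ) * (t n) ^ e) atTop (𝓝 u₀) := by
      have hnum : Tendsto (fun n : ℕ => (q : ℂ) + (m₁ : ℂ) * (n : ℂ)⁻¹) atTop (𝓝 (q : ℂ)) := by
        have h := (hinv.const_mul (m₁ : ℂ)).const_add (q : ℂ)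
        rwa [mul_zero, add_zero] at h
      have hden : Tendsto (fun n : ℕ => 2 * π * I + c n * (n : ℂ)⁻¹) atTop
          (𝓝 (2 * π * I)) := by
        have h := (hc.mul hinv).const_add (2 * π * I)
        rwa [mul_zero, add_zero] at h
      refine (hnum.div hden h2pi).congr' ?_
      filter_upwards [hrel, eventually_gt_atTop 0] with n hn hnpos
      have hn0 : (n : ℂ) ≠ 0 := Nat.cast_ne_zero.mpr hnpos.ne'
      have hden0 : 2 * π * I * n + c n ≠ 0 := by
        rw [← hn.2]; exact inv_ne_zero (pow_ne_zero _ hn.1)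
      have he1 : (q : ℂ) + (m₁ : ℂ) * (n : ℂ)⁻¹ = ((q : ℂ) * n + m₁) / n := by
        field_simp
      have he2 : 2 * π * I + c n * (n : ℂ)⁻¹ = (2 * π * I * n + c n) / n := by
        field_simp
      have hte' : (t n) ^ e = (2 * π * I * n + c n)⁻¹ := by rw [← hn.2, inv_inv]
      rw [Pi.div_apply, hte', hMC, he1, he2, div_div_div_cancel_right₀ hn0, div_eq_mul_inv]
    -- Taylor expansion of `Φ` at `0` to order `k₀ = e(d-1)`
    obtain ⟨F, hF, hΦeq⟩ := hΦan.exists_eq_sum_add_pow_mul (e * (d - 1) + 1)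
    set k₀ : ℕ := e * (d - 1) with hk₀
    set φ : ℂ := iteratedDeriv k₀ Φ 0 with hφ
    have hΦeq' : ∀ z, Φ z = z ^ k₀ * (φ / (k₀.factorial : ℂ)) + z ^ (k₀ + 1) * F z := by
      intro z
      rw [hΦeq z, Finset.sum_range_succ, Finset.sum_eq_zero (fun i hi => ?_)]
      · simp only [smul_eq_mul, zero_add]
        ring
      · rw [Finset.mem_range] at hi
        rw [hvan i hi, smul_zero]
    have hFt : Tendsto (fun n => F (t n)) atTop (𝓝 (F 0)) := hF.continuousAt.tendsto.comp ht
    have hkey : ∀ n, (M n : ℂ) ^ (d - 1) * ((q : ℂ) * Φ (t n) / (2 * π * I)) =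
        u₀ * (((M n : ℂ) * (t n) ^ e) ^ (d - 1) * (φ / (k₀.factorial : ℂ)) +
          ((M n : ℂ) * (t n) ^ e) ^ (d - 1) * t n * F (t n)) := by
      intro n
      rw [hΦeq' (t n), hu₀, hk₀, pow_succ, pow_mul, mul_pow]
      ring
    have hlim : Tendsto (fun n => (M n : ℂ) ^ (d - 1) * ((q : ℂ) * Φ (t n) / (2 * π * I)))
        atTop (𝓝 (u₀ * (u₀ ^ (d - 1) * (φ / (k₀.factorial : ℂ)) +
          u₀ ^ (d - 1) * 0 * F 0))) := by
      have h := (((hu.pow (d - 1)).mul_const (φ / (k₀.factorial : ℂ))).add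
        (((hu.pow (d - 1)).mul ht).mul hFt)).const_mul u₀
      exact h.congr fun n => (hkey n).symm
    set κ : ℂ := u₀ * (u₀ ^ (d - 1) * (φ / (k₀.factorial : ℂ))) with hκ_def
    have hlimκ : Tendsto (fun n => (M n : ℂ) ^ (f.natDegree - 1) *
        ((q : ℂ) * Φ (t n) / (2 * π * I))) atTop (𝓝 κ) := by
      rw [hfdeg]
      have : u₀ * (u₀ ^ (d - 1) * (φ / (k₀.factorial : ℂ)) + u₀ ^ (d - 1) * 0 * F 0) = κ := by
        rw [hκ_def]; ring
      rw [← this]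
      exact hlim
    -- `κ = (q/(2i))^d φ/k₀! · π^{-d}` is zero or transcendental
    have hκ : IsAlgebraic ℚ κ → κ = 0 := by
      intro hκalg
      refine eq_zero_of_isAlgebraic_of_mul_pi_pow hdpos ?_ hκalg
      have hπ : (π : ℂ) ≠ 0 := Complex.ofReal_ne_zero.mpr Real.pi_ne_zero
      have hu₀π : u₀ * (π : ℂ) = (q : ℂ) / (2 * I) := by
        rw [hu₀]
        field_simp
      have hident : κ * (π : ℂ) ^ d = ((q : ℂ) / (2 * I)) ^ d * (φ / (k₀.factorial : ℂ)) := by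
        obtain ⟨d', hd'⟩ : ∃ d', d = d' + 1 := ⟨d - 1, by omega⟩
        rw [← hu₀π, hκ_def, hd', Nat.add_sub_cancel]
        ring
      rw [hident, div_eq_mul_inv, div_eq_mul_inv]
      exact (((isAlgebraic_nat q).mul (IsAlgebraic.inv_iff.mpr
        ((isAlgebraic_nat 2).mul Complex.isIntegral_rat_I.isAlgebraic))).pow d).mul ((hcoef k₀).mul
        (IsAlgebraic.inv_iff.mpr (isAlgebraic_nat _)))
    -- norm descent along `M n`
    have hfin := finite_setOf_slope_hit_of_normLimit_seq hnorat hroot hsimple hMtop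
      (r := fun n => (q : ℂ) * Φ (t n) / (2 * π * I)) hlimκ hκ
    refine hfin.subset ?_
    rintro n ⟨L, hL⟩
    refine ⟨L, ?_⟩
    rw [hMC]
    linear_combination hL

/-! ## Appended (lead c2, 2026-08-16): the deep pocket ALONG THE RAY

In the split the abstract sequences `t n`, `c n` of `stub_deepCuspFinite` are always the uniformiser values `t n = T σ_n` and the
logarithm values `c n = ℓu σ_n` at the ray points `σ_n = (n^{1/e})⁻¹` of a normalised cusp, where `T` (analytic, `T 0 = 0`) and `ℓu`
(analytic) satisfy the linking identity `(T σ)⁻ᵉ = 2πi σ⁻ᵉ + ℓu σ` on a punctured disc. This corollary packages the three limit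
facts (`σ_n → 0` inside the disc, `T σ_n → 0`, `ℓu σ_n → ℓu 0`, `(n^{1/e})^e = n`) once. -/

/-- The ray abscissa `w n = n^{1/e}` satisfies `(w n)^e = n` (private copy; the shared one lives in
`RigidCoreSparsityTwoSplitLemmas`). [folklore] -/
private theorem dcf_rayAbscissa_pow {e : ℕ} (he : 0 < e) (N : ℕ) :
    ((((N : ℝ) ^ ((e : ℝ)⁻¹) : ℝ) : ℂ)) ^ e = (N : ℂ) := by
  rw [← Complex.ofReal_pow, Real.rpow_inv_natCast_pow (Nat.cast_nonneg N) he.ne']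
  simp

/-- The ray points `σ_N = (N^{1/e})⁻¹` tend to `0` (private copy). [folklore] -/
private theorem dcf_tendsto_rayPoint {e : ℕ} (he : 0 < e) :
    Tendsto (fun N : ℕ => ((((N : ℝ) ^ ((e : ℝ)⁻¹) : ℝ) : ℂ))⁻¹) atTop (𝓝 0) := by
  have hpos : (0 : ℝ) < (e : ℝ)⁻¹ := inv_pos.mpr (by exact_mod_cast he)
  have h1 : Tendsto (fun N : ℕ => (N : ℝ) ^ ((e : ℝ)⁻¹)) atTop atTop :=
    (tendsto_rpow_atTop hpos).comp tendsto_natCast_atTop_atTop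
  have h3 := (Complex.continuous_ofReal.tendsto 0).comp h1.inv_tendsto_atTop
  rw [Complex.ofReal_zero] at h3
  refine Tendsto.congr (fun N => ?_) h3
  simp only [Function.comp_apply, Pi.inv_apply, Complex.ofReal_inv]

/-- **The deep pocket along the ray** (corollary of `stub_deepCuspFinite`): same arithmetic hypotheses on `β` and `Φ`, with the
sequences realised as `t n = T σ_n`, `c n = ℓu σ_n` at the ray points `σ_n = (n^{1/e})⁻¹` of a uniformised cusp (`T`, `ℓu` analytic
at `0`, `T 0 = 0`, linking identity `(T σ)⁻ᵉ = 2πi σ⁻ᵉ + ℓu σ` and `T σ ≠ 0` on the punctured disc `0 < ‖σ‖ < ρ`). -/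
theorem deepCuspFinite_ray :
    ∀ (e q : ℕ) (m₁ : ℤ) (β : ℂ) (Φ T ℓu : ℂ → ℂ) (ρ : ℝ),
      0 < e → 0 < q → β.im = 0 → IsAlgebraic ℚ β →
      AnalyticAt ℂ Φ 0 → Φ 0 = 0 → (¬ ∀ᶠ z in 𝓝 (0 : ℂ), Φ z = 0) →
      (∀ n : ℕ, IsAlgebraic ℚ (iteratedDeriv n Φ 0)) →
      (∀ j : ℕ, j < e * ((minpoly ℚ β).natDegree - 1) → iteratedDeriv j Φ 0 = 0) →
      0 < ρ → AnalyticAt ℂ T 0 → T 0 = 0 → AnalyticAt ℂ ℓu 0 →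
      (∀ σ : ℂ, 0 < ‖σ‖ → ‖σ‖ < ρ → T σ ≠ 0 ∧ ((T σ) ^ e)⁻¹ = 2 * ↑π * I * σ⁻¹ ^ e + ℓu σ) →
      Set.Finite {n : ℕ | ∃ L : ℤ,
        β * ((q : ℂ) * (n : ℂ) + (m₁ : ℂ)) +
          (q : ℂ) * Φ (T ((((n : ℝ) ^ ((e : ℝ)⁻¹) : ℝ) : ℂ))⁻¹) / (2 * ↑π * I) = L} := by
  intro e q m₁ β Φ T ℓu ρ he hq hβim hβalg hΦan hΦ0 hΦne hΦalg hdepth hρ hT hT0 hu hlink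
  set w : ℕ → ℂ := fun N => (((N : ℝ) ^ ((e : ℝ)⁻¹) : ℝ) : ℂ) with hw
  have hσlim : Tendsto (fun N => (w N)⁻¹) atTop (𝓝 0) := dcf_tendsto_rayPoint he
  have hσmem : ∀ᶠ N : ℕ in atTop, 0 < ‖(w N)⁻¹‖ ∧ ‖(w N)⁻¹‖ < ρ := by
    have hne : ∀ᶠ N : ℕ in atTop, (w N)⁻¹ ≠ 0 := by
      filter_upwards [eventually_gt_atTop 0] with N hN
      exact inv_ne_zero
        (Complex.ofReal_ne_zero.mpr (Real.rpow_pos_of_pos (Nat.cast_pos.mpr hN) _).ne')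
    have hlt : ∀ᶠ N : ℕ in atTop, ‖(w N)⁻¹‖ < ρ := by
      have h := hσlim.norm
      rw [norm_zero] at h
      exact h.eventually (gt_mem_nhds hρ)
    filter_upwards [hne, hlt] with N h1 h2
    exact ⟨norm_pos_iff.mpr h1, h2⟩
  have htlim : Tendsto (fun N => T (w N)⁻¹) atTop (𝓝 0) := by
    have h := (hT.continuousAt.tendsto).comp hσlim
    rwa [hT0] at h
  have hculim : Tendsto (fun N => ℓu (w N)⁻¹) atTop (𝓝 (ℓu 0)) :=
    (hu.continuousAt.tendsto).comp hσlim
  have hrelt : ∀ᶠ n : ℕ in atTop, T (w n)⁻¹ ≠ 0 ∧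
      ((T (w n)⁻¹) ^ e)⁻¹ = 2 * ↑π * I * (n : ℂ) + ℓu (w n)⁻¹ := by
    filter_upwards [hσmem] with n hn
    obtain ⟨hT1, h3⟩ := hlink _ hn.1 hn.2
    refine ⟨hT1, ?_⟩
    rw [h3, inv_inv, dcf_rayAbscissa_pow he n]
  exact stub_deepCuspFinite e q m₁ β Φ (fun n => T (w n)⁻¹) (fun n => ℓu (w n)⁻¹) (ℓu 0) he hq hβim hβalg
    hΦan hΦ0 hΦne hΦalg hdepth htlim hculim hrelt

end Summit.Schanuel.Schanuel.Cruxes.SparsityTwo.CuspGermSchneiderSparsity
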